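import Summits.ResolutionOfSingularities.ResolutionOfSingularities.Theorems.WeightedInvariantLocalWeightedDropNCDirectrixCutAlign


/-!
# `LocalWeightedDrop`: RD-ALIGNMENT of the wild residuals and the DIRECTRIX CUT of the equimultiple phase
# (strategist line `directrix-cut` for W4|₄ = `stub_wildWideApexFourStartsWon`; the phase assembly is generic in the dimension)

[ADOPTION RECORD: this tree module is one of four files (`…NCDirectrixCutAlign` ← `…NCDirectrixCutPhase` ← `…NCDirectrixCutHist` ←
`…NCDirectrixCut`) into which res-L1-w43-stub-4 (gen 5, adoption hand, 2026-08-27) split res-L1-w43-strat-1's farm-clean strategist module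
`L/res-L1-w43-strat-1/g8/directrix_cut_v3_1.lean` (sha16 25b57d7ac1dae990, gens 7–8; offer (i) 14:58:21Z), because of the lint «Theorems files with
proofs ≤ 400 lines».  Declaration texts are VERBATIM with ONE systematic edit: the notational `abbrev Decoration.IsInv` of the source is UNFOLDED in
place and not declared (res-L1-w43-lead-1's regime vocabulary `…NCResRegimeDefs` declares `Decoration.IsInv` with the same meaning).  Author of the
mathematics and the text: res-L1-w43-strat-1.  The module-level commentary below is the author's, kept whole in each part for context.]

THIS PART (2/4): §2 — the phase assembly (RD, HighExit, EndR8, EndOrd, DState, the ordinal endgame) and §3 — the directrix cut (UnaryVertex, CoreUnary, TermLow, CoreUnaryWild/Tame).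

[OURS · L1 W4.3 · chain w43 · ENGINE crux `LocalWeightedDrop` stmt-ResolutionOfSingularities-8899; registered skeleton of record v32
(`L/res-L1-w43-lead-1/g4/LocalWeightedDrop_v32.lean`, sha16 ddb48572591139d5, registrar res-L1-w43-lead-1); strategist res-L1-w43-strat-1 gens 7–8 (v3: §5–§6 added in gen 8).
Game bookkeeping over the programme's own NC count game (res-type-056 / res-L1-w43-stub-1's S-SET decorations); NOT a statement of any manuscript;
AI-produced, weaker than expert review.  This file closes NO registered stub by name: it proves the residuals WITH EXTRA HYPOTHESES (named below).]

## §1  RD-alignment: the ORDINAL transport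
`won_of_winsOrd` — the transport `won_of_winsIn` (p507842) with well-founded induction on the GAME VALUE instead of the round number: a
TRANSFINITELY winnable position of the NC count game (`WinsOrd GermIsNC α b`, …NCGameRank) makes every divisor of a power of `b` a won germ of the
weighted game.  Hence the residual stubs follow BY NAME from the ORDINAL RANK-DROP statement
  (RD_m)  `∃ ρ : k⟦x₀..x_m⟧ → Ordinal, ∀ b ≠ 0, ¬ GermIsNC b → ∃ smooth-centre move, ρ drops at every answer`
— literally the text of the registered stub `stub_spaceNCRankDrop` (m = 2) one dimension up — instead of the uniform-in-the-answers finite round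
bound (TOT_m) of p507842: `wildWideApexFourStartsWon_of_ncRankDrop` (W4|₄ ⇐ RD₃), `wildWideApexFiveUpStartsWon_of_ncRankDrop` (W4|₅₊ ⇐ RD_{n+4}),
and — the tame maximal-contact DIMENSION DROP, ordinal form of res-type-088's `tameWideApexHigherStartsWon_of_tot_of_mono` (p506334) —
`tameWideApexFiveUpStartsWon_of_ncRankDropBelow` (T″|₅₊ at `N = n + 5` ⇐ RD_{n+3}, i.e. the NC game in ONE FEWER variable, through
`TameLift.tameWon_of_tupleDrop` + `tupleDrop_of_rank_of_monomialPhase` + `germMonomialPhase`).  So T″|₅ and W4|₄ cost the SAME statement RD₃.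

## §2  The PHASE ASSEMBLY — REBASED (v2) on res-L1-w43-stub-1's landed `…NCResPhaseAssembly` (p534993: product states `k⟦x⟧ × Decoration k m`,
germ `Prod.fst`, `Admissible` carried in the targets; `dWinsTo_germIsNC_of_headPhase`, `ncRankDrop_of_headPhase`, `ncRankDrop_of_highPhase_of_rung`).
This file adds only: `HighExit m` (the `o ≥ 2` phase WITH the normal-crossing exit — CJS-faithful: Σ^{O,max} is eliminated OR the germ resolves;
stub-1's exit-free `hhigh` implies it, `highExit_of_high`), the ORDINAL endgame (`EndOrd m`, `endOrd_of_endR8`, `DWinsTo.of_winsOrd` = transfinite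
wins are decorated wins, `dWinsTo_end_of_ordRung`, `endPhase_of_ordRung[']`), and `rd_of_highExit_of_end` / `rd_of_highExit_of_ordRung :
HighExit m → EndOrd m → RD_m` (so that the rank-drop statement one dimension LOWER can feed the endgame — see the card, stub E).

## §3  The DIRECTRIX CUT of a phase (every `m`; the new decomposition)
`UnaryVertex δ` := the initial form of the TOTAL-WITH-HISTORY `f̃ = f · ∏_{l ∈ O} X_l` (order `c = o + |O|`; TOT2-LINE v1.1 (B): e(f̃) = e^O) is
invariant under `m` linearly independent translations — i.e. `in_c(f̃) = λ·ℓ^c` is a power of ONE linear form, `e(f̃) = m = dim X`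
(over an algebraically closed field the translation-invariance vectors of a form are exactly its directrix: a homogeneous additive stabiliser is a
linear subspace, and invariance under a whole subspace `W` means the form lies in `Sym((V/W)^*)`).  The phase splits as
  `CoreUnary m` := from `e(f̃) = m`, `o ≥ 2`: reach «NC ∨ head drops ∨ (same head ∧ e(f̃) < m)» — split further into `CoreUnaryTame p m`
                   (`O ≠ ∅ ∨ p ∤ o`: maximal contact exists) and `CoreUnaryWild p m` (`O = ∅ ∧ p ∣ o`), classes preserved along equal heads;
  `TermLow m`   := from `e(f̃) < m`, `o ≥ 2`: reach «NC ∨ head drops»;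
  `phase_of_dirCut : CoreUnary m → TermLow m → Phase m` (`DWinsTo.bind`; a state with the same head has the same `o ≥ 2`).
WHY THIS CUT (m = 3, threefold hypersurface germs in 4-space, the wild residual W4|₄).  Cossart–Jannsen–Saito (LNM 2270 = arXiv:0905.2191) p.9:
«the proofs in §§11–13 show that [the key termination] Theorems 5.35 and 5.40 hold for X of ARBITRARY dimension, with the condition that the
geometric dimension of the directrix is ≤ 2»; Thm 2.10(4) (e does not increase at near points) is characteristic- and dimension-free; Thm 2.14
(near points lie on ℙ(Dir)) needs «char ≥ dim X/2 + 1» only through Hironaka's group scheme `B_{P,x′}`, which at a RATIONAL point `x′` is the line of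
`x′` — so at the closed points of our games over `k = k̄` it holds in every characteristic.  Hence `TermLow 3` is CJS-transcription (XL, in print modulo
the quoted remark), `EndOrd 3` is embedded resolution of the boundary-trace SURFACES in the regular threefold `V(f)` (CJS Thm 0.3, dimension two in a
regular ambient scheme of any dimension: in print; inside the programme it is the rank-drop statement `RD 2` — the registered `stub_spaceNCRankDrop` —
plus a sheet-separation lift, see the card), and `CoreUnary 3` — `in_c(f̃) = z^c`, `p ∣ o` forced by the engine's tangent-cone cuts — is THE OPEN
THREEFOLD CORE (the hypersurfaces `z^{p e} + …` of Cossart–Piltant 2008-II, known only by local uniformization).  At `m = 2` the same cut separates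
TOT2-LINE's S-E2′ (unary vertex, the polyhedron regime) from S-E1/S-E0/S-CRV.

## §4  BY NAME
`wildWideApexFourStartsWon_of_dirCut : CoreUnaryWild₃ → CoreUnaryTame₃ → TermLow₃ → EndOrd₃ → W4|₄` (statement of the registered stub VERBATIM), sorry-free;
`spaceNCRankDrop_of_dirCut : CoreUnary₂ → TermLow₂ → EndOrd₂ → (text of stub_spaceNCRankDrop)`.
## §5  The HISTORY-FIRST cut (v3, every `m`) — the cut of record for the line from gen 8 on
`OldExit m` (an old letter is present: the old component is a RIGID hypersurface of maximal contact for free — (P2) + «same head keeps `|O|`»; at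
`m = 3` its content is Kawanoue–Matsuki's IFP resolution in ambient dimension 3, arXiv:1205.4556, applied on the old component, modulo the game
dictionary) · `FreeLow m` (`O = ∅`, `f` not unary: the GENUINE CJS regime — condition (3e) `e_x ≤ 2` holds at `m = 3`) · `FreeTame p m` (`O = ∅`, unary,
`p ∤ o`: Giraud contact + the same threefold marked-ideal game) · `CoreUnaryWild p m` (unchanged: THE open core); `highExit_of_histCut`, `rd_of_histCut`.
The apex sub-cut of `FreeLow`: its `e = 0` and `e = 1`-isolated parts are TREE THEOREMS for every `m` (`dWinsTo_headDrop_of_apexTrivial` p537041,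
`TOT2E1.dWinsTo_headDrop_of_isolated` p536552), leaving `ApexLineCurveExit m` (`e = 1` on an equimultiple formal curve; L, OURS) and `ApexPlaneExit m`
(`2 ≤ e ≤ m - 1`; at `m = 3`: CJS Thms 5.35/5.40 one ambient dimension up; XXL): `freeLow_of_apexCut`, `rd_of_histApexCut`.
ERRATUM to §3's reading «`TermLow 3` is CJS-transcription»: `TermLow` (v2) contains the states «`|O| = 1`, `e_x(f) = 3`, `p ∣ o`» for which CJS
Thm 5.28 (3e) fails; they belong to `OldExit` (Kawanoue–Matsuki on the old component), which is why v3 cuts by the history FIRST.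

`endOrd_of_rd : RD k m → EndOrd k (m + 1)` — stub E of the line IS the registered door stub one dimension lower (res-D-pv-006 p539872
`NCTransport.exists_winsOrd_orderOne_mul_prod_of_rankDrop`); `rd_succ_of_histApexCut` = the inductive form (RD_{m+1}) ⟸ five pieces + (RD_m).

## §6  BY NAME (v3)
`wildWideApexFourStartsWon_of_histCut : CoreUnaryWild₃ → FreeTame₃ → OldExit₃ → ApexLineCurveExit₃ → ApexPlaneExit₃ → (door text) → W4|₄`
(W4|₄ and the door `stub_spaceNCRankDrop` both VERBATIM from v32), sorry-free; `rd_three_of_histCut` (the five pieces + `RD k 2` give `RD k 3`, which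
T″|₅ consumes through `tameWideApexFiveUpStartsWon_of_ncRankDropBelow`).
-/


set_option linter.dupNamespace false -- mandated namespace of this single-conjunct summit

noncomputable section

open Literature.AlgebraicGeometry.Resolution

namespace Summit.ResolutionOfSingularities.ResolutionOfSingularities.Theorems

/-! ## §2 The phase assembly, rebased on `…NCResPhaseAssembly` (every `m`) -/

namespace TameFourTupleDrop

open MvPowerSeries

variable {k : Type} [Field k] {m : ℕ}

/-- The admissible subtype of the product states (res-D-pv-006's endgame state type). -/
abbrev DState (k : Type) [Field k] (m : ℕ) : Type :=
  {p : MvPowerSeries (Fin (m + 1)) k × Decoration k m // Admissible p.1 p.2}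

/-- Its germ. -/
abbrev DState.germ (σ : DState k m) : MvPowerSeries (Fin (m + 1)) k := σ.1.1

/-- `RD`: THE ORDINAL RANK-DROP STATEMENT in `m + 1` variables (the text of `stub_spaceNCRankDrop` at `m = 2`). -/
def RD (k : Type) [Field k] (m : ℕ) : Prop :=
  ∃ ρ : MvPowerSeries (Fin (m + 1)) k → Ordinal.{0}, ∀ b : MvPowerSeries (Fin (m + 1)) k, b ≠ 0 → ¬ GermIsNC b →
    ∃ (Φ : Fin (m + 1) → MvPowerSeries (Fin (m + 1)) k) (w : Fin (m + 1) → ℕ),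
      IsCountMove Φ w ∧ MoveClause b Φ w (fun b' => ρ b' < ρ b)

/-- `HighExit`: THE `o ≥ 2` PHASE WITH THE NORMAL-CROSSING EXIT — from every admissibly decorated position with `o ≥ 2` the mover forces «the germ is
a normal crossing, or an admissibly decorated position of strictly smaller head `(o, c)`» (the `o ≥ 2` restriction of the hypothesis of
`dWinsTo_germIsNC_of_headPhase`). -/
def HighExit (k : Type) [Field k] (m : ℕ) : Prop :=
  ∀ (b : MvPowerSeries (Fin (m + 1)) k) (δ : Decoration k m), Admissible b δ → 2 ≤ δ.o →
    DWinsTo (St := MvPowerSeries (Fin (m + 1)) k × Decoration k m) Prod.fst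
      (fun τ => GermIsNC τ.1 ∨ (Admissible τ.1 τ.2 ∧ τ.2.head < δ.head)) (b, δ)

/-- stub-1's exit-free `o ≥ 2` phase (`hhigh` of `ncRankDrop_of_highPhase_of_rung`) gives `HighExit`. -/
theorem highExit_of_high
    (hhigh : ∀ (b : MvPowerSeries (Fin (m + 1)) k) (δ : Decoration k m), Admissible b δ → 2 ≤ δ.o →
      DWinsTo (St := MvPowerSeries (Fin (m + 1)) k × Decoration k m) Prod.fst
        (fun τ => Admissible τ.1 τ.2 ∧ τ.2.head < δ.head) (b, δ)) : HighExit k m :=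
  fun b δ hadm ho => (hhigh b δ hadm ho).mono fun _ hτ => Or.inr hτ

/-- `EndR8`: THE BARE ENDGAME RUNG R8 — an order-one germ times boundary letters is NC-winnable in finitely many rounds. -/
def EndR8 (k : Type) [Field k] (m : ℕ) : Prop :=
  ∀ f : MvPowerSeries (Fin (m + 1)) k, f.order = 1 → ∀ E : Finset (Fin (m + 1)),
    ∃ n, WinsIn (m := m) GermIsNC n (f * ∏ l ∈ E, X l)

/-- `EndOrd`: THE ORDINAL ENDGAME RUNG — an order-one germ times boundary letters is TRANSFINITELY NC-winnable. -/
def EndOrd (k : Type) [Field k] (m : ℕ) : Prop :=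
  ∀ f : MvPowerSeries (Fin (m + 1)) k, f.order = 1 → ∀ E : Finset (Fin (m + 1)),
    ∃ α : Ordinal.{0}, WinsOrd (m := m) GermIsNC α (f * ∏ l ∈ E, X l)

/-- The finite rung R8 gives the ordinal rung. -/
theorem endOrd_of_endR8 (h : EndR8 k m) : EndOrd k m := fun f hf E => by
  obtain ⟨n, hn⟩ := h f hf E
  exact ⟨_, winsOrd_of_winsIn hn⟩

/-- **TRANSFINITE WINS ARE DECORATED WINS** (ordinal analogue of `DWinsTo.of_winsIn`, p530487): if decorated states carry non-zero germs and every
non-zero germ is carried, a state whose germ is transfinitely winnable (terminal predicate `P`) wins towards `P ∘ germ` in the decorated sense.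
Region: the states with a transfinitely winnable germ; measure: the least winning value. -/
theorem DWinsTo.of_winsOrd {St : Type} {germ : St → MvPowerSeries (Fin (m + 1)) k} {P : MvPowerSeries (Fin (m + 1)) k → Prop}
    (h0 : ∀ τ : St, germ τ ≠ 0) (hsurj : ∀ b : MvPowerSeries (Fin (m + 1)) k, b ≠ 0 → ∃ τ : St, germ τ = b)
    {σ : St} {α : Ordinal.{0}} (hσ : WinsOrd P α (germ σ)) : DWinsTo germ (fun τ => P (germ τ)) σ := by
  classical
  refine DWinsTo.of_measure (germ := germ) {τ : St | ∃ α, WinsOrd P α (germ τ)}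
    (fun τ => sInf {α : Ordinal.{0} | WinsOrd P α (germ τ)}) ?_ ⟨α, hσ⟩
  intro τ hτ hP
  have hne : ({α : Ordinal.{0} | WinsOrd P α (germ τ)}).Nonempty := hτ
  have hmin : WinsOrd P (sInf {α : Ordinal.{0} | WinsOrd P α (germ τ)}) (germ τ) := csInf_mem hne
  obtain ⟨Φ, w, hmv, hclause⟩ := hmin.exists_move hP
  refine ⟨Φ, w, hmv, (MoveClause.and_ne_zero (h0 τ) hmv hclause).mono ?_⟩
  rintro b' ⟨hb', β, hβ, hwin'⟩
  obtain ⟨τ', hτ'b⟩ := hsurj b' hb'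
  have hwinτ' : WinsOrd P β (germ τ') := by rw [hτ'b]; exact hwin'
  exact ⟨τ', hτ'b, Or.inr ⟨⟨β, hwinτ'⟩, lt_of_le_of_lt (csInf_le' hwinτ') hβ⟩⟩

/-- **THE DECORATED ENDGAME `o ≤ 1` FROM THE ORDINAL RUNG, on the admissible subtype** (ordinal analogue of res-D-pv-006's `dWinsTo_end_of_rung`):
`o = 0` is a normal crossing (`germIsNC_of_admissible_of_o_eq_zero`); for `o = 1` the total equation is transfinitely winnable by `EndOrd`, radical
transport `winsOrd_of_dvd_pow` carries the win to the germ, and `DWinsTo.of_winsOrd` decorates it. -/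
theorem dWinsTo_end_of_ordRung (hE : EndOrd k m) (σ : DState k m) (ho : σ.1.2.o ≤ 1) :
    DWinsTo (DState.germ (k := k) (m := m)) (fun τ => GermIsNC τ.1.1) σ := by
  rcases Nat.eq_zero_or_pos σ.1.2.o with h0 | hpos
  · exact DWinsTo.of_target (germIsNC_of_admissible_of_o_eq_zero σ.2 h0)
  · obtain ⟨⟨M, N, hbM, -⟩, hsq, -⟩ := σ.2
    have hf : σ.1.2.f ≠ 0 := hsq.ne_zero
    have htot0 : σ.1.2.total ≠ 0 :=
      mul_ne_zero hf (Finset.prod_ne_zero_iff.mpr fun l _ => (MvPowerSeries.prime_X' k l).ne_zero)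
    have horder : σ.1.2.f.order = 1 := by
      have hne : σ.1.2.f.order ≠ ⊤ := fun h => hf (order_eq_top_iff.mp h)
      have h := ENat.coe_toNat hne
      rw [show (σ.1.2.f.order).toNat = 1 from le_antisymm ho hpos] at h
      exact h.symm
    obtain ⟨α, hα⟩ := hE σ.1.2.f horder σ.1.2.E
    have hb : WinsOrd (m := m) GermIsNC α σ.1.1 :=
      winsOrd_of_dvd_pow (fun N b d hd hnc hbd => germIsNC_of_dvd_pow N b d hd hnc hbd) htot0 hα hbM
    exact DWinsTo.of_winsOrd (germ := DState.germ (k := k) (m := m)) (fun τ => ne_zero_of_admissible τ.2)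
      (fun b hb => ⟨⟨(b, Decoration.start (sqfRep b)), admissible_start hb⟩, rfl⟩) hb

/-- The same on PRODUCT states (transport off the subtype, as in stub-1's `endPhase_of_rung`). -/
theorem endPhase_of_ordRung (hE : EndOrd k m)
    (b : MvPowerSeries (Fin (m + 1)) k) (δ : Decoration k m) (hadm : Admissible b δ) (ho : δ.o ≤ 1) :
    DWinsTo (St := MvPowerSeries (Fin (m + 1)) k × Decoration k m) Prod.fst (fun τ => GermIsNC τ.1) (b, δ) :=
  (dWinsTo_end_of_ordRung hE ⟨(b, δ), hadm⟩ ho).map (germ := Prod.fst)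
    (germ' := fun τ : {p : MvPowerSeries (Fin (m + 1)) k × Decoration k m // Admissible p.1 p.2} => τ.1.1)
    (Q := fun τ : MvPowerSeries (Fin (m + 1)) k × Decoration k m => GermIsNC τ.1)
    Subtype.val (fun _ => rfl) (fun _ hq => hq)

/-- The endgame half of the head phase from the ordinal rung (target widened to the head-phase disjunction). -/
theorem endPhase_of_ordRung' (hE : EndOrd k m)
    (b : MvPowerSeries (Fin (m + 1)) k) (δ : Decoration k m) (hadm : Admissible b δ) (ho : δ.o ≤ 1) :
    DWinsTo (St := MvPowerSeries (Fin (m + 1)) k × Decoration k m) Prod.fst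
      (fun τ => GermIsNC τ.1 ∨ (Admissible τ.1 τ.2 ∧ τ.2.head < δ.head)) (b, δ) :=
  (endPhase_of_ordRung hE b δ hadm ho).mono fun _ hτ => Or.inl hτ

/-- **(RD_m) FROM THE `o ≥ 2` PHASE WITH EXIT AND A DECORATED ENDGAME** (stub-1's `ncRankDrop_of_headPhase` after a case split on `o`). -/
theorem rd_of_highExit_of_end (hhigh : HighExit k m)
    (hend : ∀ (b : MvPowerSeries (Fin (m + 1)) k) (δ : Decoration k m), Admissible b δ → δ.o ≤ 1 →
      DWinsTo (St := MvPowerSeries (Fin (m + 1)) k × Decoration k m) Prod.fst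
        (fun τ => GermIsNC τ.1 ∨ (Admissible τ.1 τ.2 ∧ τ.2.head < δ.head)) (b, δ)) : RD k m :=
  ncRankDrop_of_headPhase fun b δ hadm => by
    rcases Nat.lt_or_ge δ.o 2 with h2 | h2
    · exact hend b δ hadm (by omega)
    · exact hhigh b δ hadm h2

/-- (RD_m) from the `o ≥ 2` phase with exit and the ORDINAL endgame rung. -/
theorem rd_of_highExit_of_ordRung (hhigh : HighExit k m) (hE : EndOrd k m) : RD k m :=
  rd_of_highExit_of_end hhigh (endPhase_of_ordRung' hE)

/-- (RD_m) from the `o ≥ 2` phase with exit and the FINITE rung R8 (stub-1's `endPhase_of_rung'`). -/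
theorem rd_of_highExit_of_rung (hhigh : HighExit k m) (hR8 : EndR8 k m) : RD k m :=
  rd_of_highExit_of_end hhigh (endPhase_of_rung' hR8)

/-! ## §3 The directrix cut of the `o ≥ 2` phase (every `m`) -/

/-- The TOTAL-WITH-HISTORY equation `f̃ = f · ∏_{l ∈ O} X_l` of a decoration (order `c = o + |O|` at an admissible state). -/
def Decoration.histTotal (δ : Decoration k m) : MvPowerSeries (Fin (m + 1)) k := δ.f * ∏ l ∈ δ.O, X l

/-- `UnaryVertex δ`: the degree-`c` initial form of `f̃` is invariant under `m` linearly independent translations — over an algebraically closed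
field: `in_c(f̃) = λ · ℓ^c` for a linear form `ℓ`, i.e. the directrix of `f̃` (= Dir^O, TOT2-LINE v1.1 (B)) is a hyperplane, `e^O = m`. -/
def UnaryVertex (δ : Decoration k m) : Prop :=
  ∃ cv : Fin m → (Fin (m + 1) → k), LinearIndependent k cv ∧
    ∀ (j : Fin m) (v : Fin (m + 1) → k),
      CobordantChart.initEval (fun _ => 1) (v + cv j) δ.c δ.histTotal = CobordantChart.initEval (fun _ => 1) v δ.c δ.histTotal

/-- `CoreUnary`: from every admissibly decorated UNARY vertex with `o ≥ 2` the mover forces «NC, or admissible with smaller head, or admissible with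
the same head and NO LONGER unary». -/
def CoreUnary (k : Type) [Field k] (m : ℕ) : Prop :=
  ∀ (b : MvPowerSeries (Fin (m + 1)) k) (δ : Decoration k m), Admissible b δ → 2 ≤ δ.o → UnaryVertex δ →
    DWinsTo (St := MvPowerSeries (Fin (m + 1)) k × Decoration k m) Prod.fst
      (fun τ => GermIsNC τ.1 ∨ (Admissible τ.1 τ.2 ∧ (τ.2.head < δ.head ∨ (τ.2.head = δ.head ∧ ¬ UnaryVertex τ.2)))) (b, δ)

/-- `TermLow`: from every admissibly decorated NON-unary vertex with `o ≥ 2` (`e^O ≤ m - 1`, the CJS regime at `m = 3`) the mover forces «NC, or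
admissible with smaller head». -/
def TermLow (k : Type) [Field k] (m : ℕ) : Prop :=
  ∀ (b : MvPowerSeries (Fin (m + 1)) k) (δ : Decoration k m), Admissible b δ → 2 ≤ δ.o → ¬ UnaryVertex δ →
    DWinsTo (St := MvPowerSeries (Fin (m + 1)) k × Decoration k m) Prod.fst
      (fun τ => GermIsNC τ.1 ∨ (Admissible τ.1 τ.2 ∧ τ.2.head < δ.head)) (b, δ)

/-- **THE CUT COMPOSES** (`DWinsTo.bind`; equal heads have equal `o ≥ 2`): `CoreUnary`, `TermLow` ⊢ `HighExit`. -/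
theorem highExit_of_dirCut (hcore : CoreUnary k m) (hterm : TermLow k m) : HighExit k m := by
  intro b δ hadm ho
  by_cases hU : UnaryVertex δ
  · refine (hcore b δ hadm ho hU).bind fun τ hτ => ?_
    rcases hτ with hnc | ⟨hadmτ, hlt | ⟨heq, hnU⟩⟩
    · exact DWinsTo.of_target (Or.inl hnc)
    · exact DWinsTo.of_target (Or.inr ⟨hadmτ, hlt⟩)
    · have hoτ : 2 ≤ τ.2.o := by
        have h' := heq
        rw [Decoration.head, Decoration.head, toLex_inj] at h'
        have hoo : τ.2.o = δ.o := (Prod.ext_iff.mp h').1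
        rw [hoo]
        exact ho
      have hwin := hterm τ.1 τ.2 hadmτ hoτ hnU
      rw [heq] at hwin
      exact hwin
  · exact hterm b δ hadm ho hU

/-! ### Tame and wild unary vertices
At a unary vertex with `O = ∅` one has `f̃ = f`, `c = o`, `in_o f = λ ℓ^o`: if `p ∤ o` the hypersurface of maximal contact `D^{(o-1)} f = 0` exists
(TAME); if `p ∣ o` it does not (WILD — Narasimhan).  With `O ≠ ∅` unary forces `O = {l}`, `in_o f = λ X_l^o` up to the letter, `c = o + 1`, and one
of `o`, `c` is prime to `p` (TAME via `f` or via `f̃`).  Along successors with the SAME head, `o` and `|O| = c - o` are unchanged, so the classes do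
not mix: the sub-cores compose by restriction (`coreUnary_of_tame_of_wild`). -/

/-- `CoreUnaryWild p`: `CoreUnary` restricted to the WILD unary vertices `O = ∅ ∧ p ∣ o` — THE OPEN THREEFOLD CORE at `m = 3`. -/
def CoreUnaryWild (p : ℕ) (k : Type) [Field k] (m : ℕ) : Prop :=
  ∀ (b : MvPowerSeries (Fin (m + 1)) k) (δ : Decoration k m), Admissible b δ → 2 ≤ δ.o → UnaryVertex δ → δ.O = ∅ → p ∣ δ.o →
    DWinsTo (St := MvPowerSeries (Fin (m + 1)) k × Decoration k m) Prod.fst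
      (fun τ => GermIsNC τ.1 ∨ (Admissible τ.1 τ.2 ∧ (τ.2.head < δ.head ∨ (τ.2.head = δ.head ∧ ¬ UnaryVertex τ.2)))) (b, δ)

/-- `CoreUnaryTame p`: `CoreUnary` restricted to the TAME unary vertices `¬ (O = ∅ ∧ p ∣ o)` — maximal contact exists (Kawanoue–Matsuki at `m = 3`). -/
def CoreUnaryTame (p : ℕ) (k : Type) [Field k] (m : ℕ) : Prop :=
  ∀ (b : MvPowerSeries (Fin (m + 1)) k) (δ : Decoration k m), Admissible b δ → 2 ≤ δ.o → UnaryVertex δ → ¬ (δ.O = ∅ ∧ p ∣ δ.o) →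
    DWinsTo (St := MvPowerSeries (Fin (m + 1)) k × Decoration k m) Prod.fst
      (fun τ => GermIsNC τ.1 ∨ (Admissible τ.1 τ.2 ∧ (τ.2.head < δ.head ∨ (τ.2.head = δ.head ∧ ¬ UnaryVertex τ.2)))) (b, δ)

/-- The two sub-cores give the core (case split; no interaction). -/
theorem coreUnary_of_tame_of_wild {p : ℕ} (htame : CoreUnaryTame p k m) (hwild : CoreUnaryWild p k m) : CoreUnary k m := by
  intro b δ hadm ho hU
  by_cases h : δ.O = ∅ ∧ p ∣ δ.o
  · exact hwild b δ hadm ho hU h.1 h.2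
  · exact htame b δ hadm ho hU h

/-- (RD_m) from the three pieces of the cut and the ordinal endgame rung. -/
theorem rd_of_dirCut (hcore : CoreUnary k m) (hterm : TermLow k m) (hend : EndOrd k m) : RD k m :=
  rd_of_highExit_of_ordRung (highExit_of_dirCut hcore hterm) hend


end TameFourTupleDrop

end Summit.ResolutionOfSingularities.ResolutionOfSingularities.Theorems

end
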